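import Summits.BirchSwinnertonDyer.BirchSwinnertonDyer.Theorems.ByReductionTypeAtTwoRankOneAtTwoBigImageOddLocalFklPrimeLevelDictionary
import Literature.NumberTheory.EllipticCurves.PAdicLFunctionIntegralityAtTwoProofs
import HarnessLib

/-!
# Line `fkl` of crux `RankOneAtTwoBigImageOddLocal` (stmt-BirchSwinnertonDyer-23715, route ByReductionTypeAtTwo):
# the WHOLE LEVEL-ONE LAYER of the hardest stub K2-F (a) is a THEOREM

Lead prover seat `bsd-line-fkl-p1` (g0), helpers `--supports stmt-BirchSwinnertonDyer-23715` (registered stub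
`stub_katoFirstLayerLaw : F1Sign2.FirstLayerLawAtTwo`); sequel to `…FklLevelOne` (p592555: the `ℓ ≡ 3 (mod 4)` half) and
`…FklPrimeLevelDictionary` (p593426: level one ⟺ parity of the quadratic-twist symbol sum `T_ℓ(f)`).

MAIN THEOREM `twistSymbolSum_inTwoPowZLoc_one`: for the newform `f` of a globally minimal elliptic `W/ℚ` with POSITIVE
analytic rank and every odd prime `ℓ ∤ N_W`, the quadratic-twist symbol sum `T_ℓ(f) = ∑_{a mod ℓ} (a/ℓ)[a/ℓ]⁺_f` lies in
`2ℤ_{(2)}` (indeed it is an even integer).  Proof, all inputs PROVED in the tree: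
(i) `L(E,1) = 0`, so `{∞,0}_f = 0 ∈ Λ_f` and every cusp `u/ℓ` (denominator prime to the level) has `{∞, u/ℓ}_f ∈ Λ_f`
(`modularSymbol_sub_zero_mem_periodLattice`), whence `2[u/ℓ]⁺_f =: k_u ∈ ℤ` (`exists_ratPlusSymbol_eq_div_two`, `n₀ = 1`:
`re Λ_f = ℤ·Ω⁺_f/2` by definition of `Ω⁺_f`); (ii) `∑_u k_u = 2(a_ℓ − 2)[0]⁺_f = 0` (Hecke, `heckeSumAtPrimeLevel_holds`);
(iii) `T_ℓ = ½∑_u (u/ℓ) k_u = ½(∑_u k_u − ∑_u (1 − (u/ℓ)) k_u) = −∑_{(u/ℓ) = −1} k_u`; (iv) for `ℓ ≡ 1 (mod 4)` the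
non-residues are stable under `u ↦ −u`, a fixed-point-free involution with `k_{−u} = k_u`, so that sum is EVEN
(`two_dvd_sum_of_involution_invariant`, the K2-V pairing lemma); for `ℓ ≡ 3 (mod 4)`, `T_ℓ = 0` (p593426).
CONSEQUENCE `firstLayerLawAtTwo_a_levelOne`: in the setting of K2-F with analytic rank one (the slice of the crux), the
conclusion of `F1Sign2.FirstLayerLawAtTwo` (a) at `(ℓ, k = 1)` — `δ'_1(ℓ; ψ) ∈ 2^{min(1, s+1)} ℤ_{(2)}` — holds at EVERY `τ`-prime
`ℓ`, for EVERY surjective `ψ` and EVERY parameter `s`: the level-one layer of the first Kolyvagin layer at two carries no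
obstruction, unconditionally.  (BSD₂ reading: `T_ℓ(f) = L(E^{(ℓ)},1)/Ω(E^{(ℓ)})` up to the period bookkeeping, so in positive
rank the algebraic `L`-values of the prime quadratic twists `E^{(ℓ)}`, `ℓ ≡ 1 (4)`, are even — consistent with Kramer's
parity over `ℚ(√ℓ)`; not used.)  What remains open of K2-F is level `k ≥ 2`: (a) for `2 ≤ k ≤ s + 1` and the existence
clause (b) at `k ≥ s + 2` — the Mazur–Tate-type leading-term valuation at `p = 2`.
Theorems only; no `def`, no named-fact hypothesis, no `sorry`.  BSD is not proved by any of this.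
-/

set_option autoImplicit false

noncomputable section

open scoped Classical MatrixGroups ModularForm

set_option linter.dupNamespace false

namespace Summit.BirchSwinnertonDyer.BirchSwinnertonDyer.Theorems.RankOneAtTwoFkl

open CongruenceSubgroup WeierstrassCurve Literature.NumberTheory.EllipticCurves
  Literature.NumberTheory.EllipticCurves.ModularForms Summit.BirchSwinnertonDyer.Rank1Residual.F1Sign2

/-- **`2[x]⁺_f ∈ ℤ` in positive analytic rank** at every cusp `x` whose denominator is prime to the level: for the
newform `f` of `W` with `r_an(W) ≠ 0`, `{∞,0}_f = L(E,1) = 0 ∈ Λ_f` (`IsNewformOf.modularSymbol_zero_eq_entireLFunction_one`,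
`analyticRank_eq_zero_iff_holds`), so `[x]⁺_f = k/2` with `k ∈ ℤ` (`exists_ratPlusSymbol_eq_div_two` with `n₀ = 1`).
[cite: CremonaAlgorithms1997, §2.8] -/
theorem exists_ratPlusSymbol_eq_int_div_two (W : WeierstrassCurve ℚ) [W.IsElliptic]
    {M : ℕ} [NeZero M] (f : CuspForm (Gamma0 M) 2) (hf : IsNewformOf W f) (hr : W.analyticRank ≠ 0)
    {x : ℚ} (hx : Nat.Coprime x.den M) : ∃ k : ℤ, ratPlusSymbol f x = (k : ℚ) / 2 := by
  have hL : W.entireLFunction 1 = 0 := by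
    by_contra hL
    exact hr ((analyticRank_eq_zero_iff_holds (W := W) hf.hasEntireLFunction).mpr hL)
  have h0 : ((1 : ℤ) : ℂ) * modularSymbol f 0 ∈ periodLattice f := by
    rw [hf.modularSymbol_zero_eq_entireLFunction_one, hL, mul_zero]
    exact AddSubgroup.zero_mem _
  have hreal : ∀ n, (cuspCoeff f n).im = 0 :=
    cuspCoeff_im_eq_zero_of_coeffField_eq_bot hf.coeffField_eq_bot
  obtain ⟨k, hk⟩ := exists_ratPlusSymbol_eq_div_two f hreal one_ne_zero h0 hx
  exact ⟨k, by rw [hk]; push_cast; ring⟩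

/-- `(u/ℓ) = ±1` for a unit `u` modulo a prime `ℓ` (quadratic character dichotomy). [folklore] -/
theorem jacobiSym_val_eq_one_or (ℓ : ℕ) [Fact ℓ.Prime] (u : (ZMod ℓ)ˣ) :
    jacobiSym (((u : ZMod ℓ).val : ℤ)) ℓ = 1 ∨ jacobiSym (((u : ZMod ℓ).val : ℤ)) ℓ = -1 := by
  rw [jacobiSym_val_eq_quadraticChar]
  exact quadraticChar_dichotomy u.ne_zero

/-- `((−u)/ℓ) = (u/ℓ)` for `ℓ ≡ 1 (mod 4)` (`(−1/ℓ) = χ₄(ℓ) = 1`). [folklore] -/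
theorem jacobiSym_neg_unit_val_of_mod_four_eq_one {ℓ : ℕ} [Fact ℓ.Prime] (hℓ4 : ℓ % 4 = 1)
    (u : (ZMod ℓ)ˣ) :
    jacobiSym ((((-u : (ZMod ℓ)ˣ) : ZMod ℓ).val : ℤ)) ℓ = jacobiSym (((u : ZMod ℓ).val : ℤ)) ℓ := by
  have hu : (u : ZMod ℓ) ≠ 0 := u.ne_zero
  have hval : ((-u : (ZMod ℓ)ˣ) : ZMod ℓ).val = ℓ - (u : ZMod ℓ).val := by
    rw [Units.val_neg, ZMod.neg_val, if_neg hu]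
  have hle : (u : ZMod ℓ).val ≤ ℓ := (ZMod.val_lt _).le
  rw [hval, Nat.cast_sub hle, jacobiSym.mod_left]
  have hmod : ((ℓ : ℤ) - ((u : ZMod ℓ).val : ℤ)) % (ℓ : ℤ) = (-(((u : ZMod ℓ).val : ℤ))) % (ℓ : ℤ) := by
    rw [show (ℓ : ℤ) - ((u : ZMod ℓ).val : ℤ) = -(((u : ZMod ℓ).val : ℤ)) + 1 * (ℓ : ℤ) by ring,
      Int.add_mul_emod_self_right]
  rw [hmod, ← jacobiSym.mod_left, jacobiSym.neg _ (Nat.odd_iff.mpr (by omega)),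
    ZMod.χ₄_nat_one_mod_four hℓ4]
  ring

/-- `−u ≠ u` for a unit modulo an odd prime (`ZMod.ne_neg_self`). [folklore] -/
theorem neg_ne_self_unit {ℓ : ℕ} [Fact ℓ.Prime] (hℓ2 : ℓ ≠ 2) (u : (ZMod ℓ)ˣ) : -u ≠ u := by
  have hℓ : ℓ.Prime := Fact.out
  have hodd : Odd ℓ := hℓ.odd_of_ne_two hℓ2
  intro h
  have h' : ((u : ZMod ℓ)) = -(u : ZMod ℓ) := by
    have := congrArg (fun x : (ZMod ℓ)ˣ => (x : ZMod ℓ)) h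
    simp only [Units.val_neg] at this
    exact this.symm
  exact ZMod.ne_neg_self hodd u.ne_zero h'

/-- **MAIN: the quadratic-twist symbol sum is EVEN in positive analytic rank.**  For the newform `f` of a globally minimal
elliptic `W/ℚ` with `r_an(W) ≠ 0` and every odd prime `ℓ ∤ N_W`:  `T_ℓ(f) ∈ 2ℤ_{(2)}`.  (`ℓ ≡ 3 (4)`: `T_ℓ = 0`;
`ℓ ≡ 1 (4)`: `T_ℓ = −∑_{(u/ℓ)=−1} 2[u/ℓ]⁺` is a sum of integers over a `±`-stable set without fixed points, with equal
values at `±u`, hence even — see the file header.) [cite: Manin1972, Prop. 1.4 and Thm. 1.6] [cite: CremonaAlgorithms1997, §2.8] -/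
theorem twistSymbolSum_inTwoPowZLoc_one (W : WeierstrassCurve ℚ) [W.IsElliptic] [W.IsGloballyMinimal]
    {M : ℕ} [NeZero M] (f : CuspForm (Gamma0 M) 2) (hf : IsNewformOf W f) (hr : W.analyticRank ≠ 0)
    (ℓ : ℕ) [Fact ℓ.Prime] (hℓ2 : ℓ ≠ 2) (hN : ¬ ℓ ∣ W.conductorNorm ℤ) :
    InTwoPowZLoc 1 (twistSymbolSum f ℓ) := by
  have hℓ : ℓ.Prime := Fact.out
  by_cases h3 : ℓ % 4 = 3
  · rw [twistSymbolSum_eq_zero_of_mod_four_eq_three f ℓ h3]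
    exact ⟨0, by simp, by simp⟩
  have h1 : ℓ % 4 = 1 := by
    rcases hℓ.eq_two_or_odd with h | h
    · exact absurd h hℓ2
    · omega
  have hℓM : ¬ ℓ ∣ M := fun h => hN ((hf.dvd_level_iff_dvd_conductorNorm hℓ).mp h)
  have hcop : Nat.Coprime ℓ M := (Nat.Prime.coprime_iff_not_dvd hℓ).mpr hℓM
  have hcopN : Nat.Coprime (W.conductorNorm ℤ) ℓ := ((Nat.Prime.coprime_iff_not_dvd hℓ).mpr hN).symm
  -- (i) integer values `k u = 2[u/ℓ]⁺`
  have hden : ∀ u : (ZMod ℓ)ˣ, Nat.Coprime ((((u : ZMod ℓ).val : ℚ)) / ℓ).den M := fun u => by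
    have h := coprime_den_of_coprime (N := M) hcop ((u : ZMod ℓ).val : ℤ)
    rwa [Int.cast_natCast] at h
  choose k hk using fun u : (ZMod ℓ)ˣ =>
    exists_ratPlusSymbol_eq_int_div_two W f hf hr (hden u)
  -- (ii) `∑ k = 0` from the Hecke sum and `[0]⁺ = 0`
  have hsum0 : ∑ u : (ZMod ℓ)ˣ, (k u : ℚ) = 0 := by
    have h := heckeSumAtPrimeLevel_holds W f hf ℓ hcopN
    rw [ratPlusSymbol_zero_eq_zero_of_analyticRank_ne_zero W f hf hr, mul_zero] at h
    have : ∑ u : (ZMod ℓ)ˣ, (k u : ℚ) =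
        2 * ∑ u : (ZMod ℓ)ˣ, ratPlusSymbol f ((((u : ZMod ℓ).val : ℚ)) / ℓ) := by
      rw [Finset.mul_sum]
      refine Finset.sum_congr rfl fun u _ => ?_
      rw [hk u]; ring
    rw [this, h, mul_zero]
  -- `k (−u) = k u`
  have hkneg : ∀ u : (ZMod ℓ)ˣ, k (-u) = k u := fun u => by
    have h := ratPlusSymbol_neg_unit f u
    rw [hk (-u), hk u] at h
    exact_mod_cast (by linarith : (k (-u) : ℚ) = k u)
  -- (iii) the integer weight `g u = (1 − (u/ℓ))/2 · k u`
  let g : (ZMod ℓ)ˣ → ℤ := fun u => if jacobiSym (((u : ZMod ℓ).val : ℤ)) ℓ = 1 then 0 else k u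
  have hg : ∀ u : (ZMod ℓ)ˣ,
      ((1 : ℚ) - (jacobiSym (((u : ZMod ℓ).val : ℤ)) ℓ : ℚ)) * (k u : ℚ) = 2 * (g u : ℚ) := by
    intro u
    rcases jacobiSym_val_eq_one_or ℓ u with h | h
    · have hgu : g u = 0 := by simp only [g, h, if_true]
      rw [hgu, h]; push_cast; ring
    · have hgu : g u = k u := by simp only [g, h]; norm_num
      rw [hgu, h]; push_cast; ring
  -- (iv) `∑ g` is even: `u ↦ −u` on the non-residues
  have hgeven : (2 : ℤ) ∣ ∑ u : (ZMod ℓ)ˣ, g u := by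
    refine two_dvd_sum_of_involution_invariant Finset.univ (fun u => -u) (fun u _ => Finset.mem_univ _)
      (fun u _ => neg_neg u) (fun u _ => neg_ne_self_unit hℓ2 u) g fun u _ => ?_
    simp only [g, jacobiSym_neg_unit_val_of_mod_four_eq_one h1, hkneg]
  obtain ⟨m, hm⟩ := hgeven
  -- `T = ∑ (u/ℓ) k/2 = (∑ k − ∑ (1 − (u/ℓ)) k)/2 = −∑ g = −2m`
  have hT : twistSymbolSum f ℓ = -(m : ℚ) * 2 := by
    rw [twistSymbolSum_eq_sum_units]
    have step : ∑ u : (ZMod ℓ)ˣ, (jacobiSym (((u : ZMod ℓ).val : ℤ)) ℓ : ℚ) *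
        ratPlusSymbol f ((((u : ZMod ℓ).val : ℚ)) / ℓ) =
        (∑ u : (ZMod ℓ)ˣ, (k u : ℚ)) / 2 - ∑ u : (ZMod ℓ)ˣ, (g u : ℚ) := by
      rw [Finset.sum_div, ← Finset.sum_sub_distrib]
      refine Finset.sum_congr rfl fun u _ => ?_
      have := hg u
      rw [hk u]
      linear_combination (-1 / 2 : ℚ) * this
    rw [step, hsum0, zero_div, zero_sub]
    have : (∑ u : (ZMod ℓ)ˣ, (g u : ℚ)) = ((∑ u : (ZMod ℓ)ˣ, g u : ℤ) : ℚ) := by push_cast; rfl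
    rw [this, hm]; push_cast; ring
  exact ⟨-m, by rw [hT]; ring, by simp⟩

/-- **K2-F (a) AT LEVEL ONE — UNCONDITIONAL on the slice.**  For `W/ℚ` globally minimal of analytic rank `≠ 0` (on the
slice of crux `RankOneAtTwoBigImageOddLocal`: `r_an = 1`), `f` its newform at any level, EVERY `τ`-prime `ℓ`
(`IsLevelAtTwo W ℓ`), EVERY surjective `ψ : (ℤ/ℓ)ˣ → ℤ/2^1` and EVERY parameter `s : ℕ`:
`δ'_1(ℓ; ψ) ∈ 2^{min(1, s+1)} ℤ_{(2)}` — the conclusion of `F1Sign2.FirstLayerLawAtTwo` (a) at `(ℓ, k = 1)`.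
(`firstLayerLawAtTwo_a_levelOne_iff_twistSymbolSum` + `twistSymbolSum_inTwoPowZLoc_one`.)  The level-one layer of the
hardest stub of line fkl is therefore closed; levels `k ≥ 2` remain. [conjecture] corner, kernel theorem. -/
theorem firstLayerLawAtTwo_a_levelOne (W : WeierstrassCurve ℚ) [W.IsElliptic] [W.IsGloballyMinimal]
    {M : ℕ} [NeZero M] (f : CuspForm (Gamma0 M) 2) (hf : IsNewformOf W f) (han : W.analyticRank = 1)
    (s : ℕ) (ℓ : ℕ) [Fact ℓ.Prime] (hlev : IsLevelAtTwo W ℓ)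
    (ψ : (ZMod ℓ)ˣ →* Multiplicative (ZMod (2 ^ 1))) (hψ : Function.Surjective ψ) :
    InTwoPowZLoc (min 1 (s + 1)) (levelSumTwo f ℓ 1 ψ) := by
  have h2N : ¬ ℓ ∣ 2 * W.conductorNorm ℤ := (hlev.2 ℓ (dvd_refl ℓ)).1
  have hℓ2 : ℓ ≠ 2 := by
    rintro rfl
    exact h2N (dvd_mul_right 2 _)
  have hN : ¬ ℓ ∣ W.conductorNorm ℤ := fun h => h2N (dvd_mul_of_dvd_right h 2)
  rw [firstLayerLawAtTwo_a_levelOne_iff_twistSymbolSum W f hf han s ℓ hlev ψ hψ]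
  exact twistSymbolSum_inTwoPowZLoc_one W f hf (by rw [han]; exact one_ne_zero) ℓ hℓ2 hN

/-- **The level-one clause of K2-F in the binder shape of `F1Sign2.FirstLayerLawAtTwo`** (with the analytic rank in place
of `w = −1 ∧ rank = 1 ∧ Ш[2^∞] finite`, which on the slice are equivalent modulo GZK): for every globally minimal elliptic
`W/ℚ` of analytic rank one, every newform `f` of `W`, every `τ`-prime `ℓ` at level `k = 1` (`2 ∣ ℓ − 1`, `2 ∣ a_ℓ − 2`)
and every surjective `ψ`, clause (a) holds for every `s`.  The hypotheses period transfer / big image / odd torsion / odd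
Tamagawa of K2-F are idle at level one. [conjecture] corner, kernel theorem. -/
theorem firstLayerLawAtTwo_levelOne_clause :
    ∀ (W : WeierstrassCurve ℚ) [W.IsElliptic] [W.IsGloballyMinimal] {M : ℕ} [NeZero M]
      (f : CuspForm (Gamma0 M) 2), IsNewformOf W f → W.analyticRank = 1 →
      ∀ (s ℓ : ℕ) [Fact ℓ.Prime], IsLevelAtTwo W ℓ → 1 ≤ 1 → (2 ^ 1 : ℤ) ∣ (ℓ : ℤ) - 1 →
        (2 ^ 1 : ℤ) ∣ W.frobeniusTrace ℓ - 2 →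
        ∀ ψ : (ZMod ℓ)ˣ →* Multiplicative (ZMod (2 ^ 1)), Function.Surjective ψ →
          InTwoPowZLoc (min 1 (s + 1)) (levelSumTwo f ℓ 1 ψ) :=
  fun W _ _ _ _ f hf han s ℓ _ hlev _ _ _ ψ hψ => firstLayerLawAtTwo_a_levelOne W f hf han s ℓ hlev ψ hψ

end Summit.BirchSwinnertonDyer.BirchSwinnertonDyer.Theorems.RankOneAtTwoFkl

end
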